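import Summits.ResolutionOfSingularities.ResolutionOfSingularities.Theorems.MarkedTransferCampaignW46LooseExitTreeBranching
import Summits.ResolutionOfSingularities.ResolutionOfSingularities.Theorems.MarkedTransferCampaignW46LooseThreadFollowed
import HarnessLib

/-!
# [OURS · L1 W4.6 rung (i-b)] The loose exit tree is FINITE (König + the loose thread-chain theorem); the centre
# inequality of rung (i-b)
# (cell res-hironaka, LADDER-RESOLUTION rung L, D-0089; campaign s46, prover res-L1-s46-pv-1; host route MarkedTransfer,
# `--supports stmt-ResolutionOfSingularities-16155`)

HONEST FRAMING. Nothing here is a statement of H. Hironaka's manuscript (2017-03-23, [Hironaka2017]); pure commutative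
algebra inside a field `K`, joining the loose exit tree (`MarkedTransferCampaignW46LooseExitTree*.lean`) to the loose
thread-chain theorem (`CampaignW46.not_isLooseThreadChain`, `MarkedTransferCampaignW46LooseThreadFollowed.lean`). AI-written;
weaker than expert review. No `sorry`; axioms standard.

## Contents

* `looseExitTree_subset_insert_biUnion`, `exists_looseStep_infinite`, `finite_looseExitTree_of_no_infinite_branch` — König's
  lemma for the (finitely branching) loose tree, as for the marked tree (`…ExitTreeKonig.lean`, res-L1-s46-pv-8).
* `isLooseThreadChain_of_branch` — **an infinite sequence of loose steps is a loose thread chain** (exponent `b`, division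
  exponents the loose exponents `b·⌊ord J_i/b⌋`): every node of the branch is the source of a step, hence isolated.
* **`finite_looseExitTree`** — the loose exit tree above EVERY node is finite (`not_isLooseThreadChain`).
* **`sum_looseExitCount_lt_of_isIsolatedNode`** — THE CENTRE INEQUALITY of rung (i-b): at an isolated node `⟨S, J⟩`, for
  every finite set `F` of distinct two-dimensional first quadratic transforms `S'`,
  `∑_{S' ∈ F} ν̃(S', (J S' : x^m), b) < ν̃(S, J, b)`.

## References

* D. Kőnig's infinity lemma. [folklore]
* O. Zariski, P. Samuel, *Commutative Algebra* II (1960), Appendix 5. [ZariskiSamuel1960]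
-/

noncomputable section

open IsLocalRing

-- single-problem summit: the doubled namespace component `ResolutionOfSingularities` is forced
set_option linter.dupNamespace false

namespace Summit.ResolutionOfSingularities.ResolutionOfSingularities.Theorems.CampaignW46

open Literature.AlgebraicGeometry.Resolution

universe u

variable {K : Type u} [Field K] {b : ℕ}

/-! ## König for the loose tree -/

/-- The loose tree above `n` decomposes into `{n}` and the loose trees above the singular children of `n`. [folklore] -/
theorem looseExitTree_subset_insert_biUnion (n : MarkedNode K) :
    looseExitTree b n ⊆ insert n (⋃ n₁ ∈ {n₁ : MarkedNode K | LooseStep b n n₁ ∧ IsSingularNode b n₁},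
      looseExitTree b n₁) := by
  intro m hm
  rcases mem_looseExitTree_cases hm with rfl | ⟨n₁, h₁, hm₁⟩
  · exact Set.mem_insert _ _
  · refine Set.mem_insert_of_mem _ (Set.mem_iUnion₂.mpr ⟨n₁, ⟨h₁, ?_⟩, hm₁⟩)
    -- `n₁` is singular: it is `m` itself, or the (isolated) source of a further step
    rcases mem_looseExitTree_cases hm₁ with rfl | ⟨n₂, h₂, -⟩
    · exact hm₁.2
    · exact h₂.isIsolatedNode.isSingularNode

/-- **König step**: if the loose tree above `n` is infinite then so is the loose tree above one of the (finitely many)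
singular children of `n`. [folklore] -/
theorem exists_looseStep_infinite {n : MarkedNode K} (hinf : (looseExitTree b n).Infinite) :
    ∃ n₁, LooseStep b n n₁ ∧ (looseExitTree b n₁).Infinite := by
  by_contra hall
  push Not at hall
  apply hinf
  refine (((finite_setOf_looseStep_isSingularNode b n).biUnion' fun n₁ hn₁ => ?_).insert n).subset
    (looseExitTree_subset_insert_biUnion n)
  exact hall n₁ hn₁.1

/-- **König's lemma for the loose tree**: if there is no infinite sequence of loose steps out of `n₀`, the loose tree
above `n₀` is finite. [cite: ZariskiSamuel1960, Appendix 5] -/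
theorem finite_looseExitTree_of_no_infinite_branch (n₀ : MarkedNode K)
    (hno : ∀ c : ℕ → MarkedNode K, c 0 = n₀ → (∀ i, LooseStep b (c i) (c (i + 1))) → False) :
    (looseExitTree b n₀).Finite := by
  classical
  by_contra hinf
  rw [Set.not_finite] at hinf
  let P : MarkedNode K → Prop := fun n => (looseExitTree b n).Infinite
  have step : ∀ n, P n → ∃ n₁, P n₁ ∧ LooseStep b n n₁ := fun n hn => by
    obtain ⟨n₁, h₁, hinf₁⟩ := exists_looseStep_infinite hn
    exact ⟨n₁, hinf₁, h₁⟩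
  choose next hnextP hnextStep using step
  -- the infinite branch
  let seq : ℕ → {n : MarkedNode K // P n} :=
    fun i => Nat.rec ⟨n₀, hinf⟩ (fun _ n => ⟨next n.1 n.2, hnextP n.1 n.2⟩) i
  exact hno (fun i => (seq i).1) rfl fun i => hnextStep (seq i).1 (seq i).2

/-! ## An infinite branch of the loose tree is a loose thread chain -/

/-- **An infinite sequence of loose steps is a loose thread chain** with exponent `b` and division exponents the loose
exponents `m_i = b·⌊ord J_i / b⌋`: the rings are two-dimensional regular local rings of `K`, consecutive quadratic
transforms; every node is the SOURCE of a step, hence isolated (singular, `J_i ⊄ (q^b)`, Japanese quotients); and the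
loose transform obeys the product law `(x^{m_i}) · J_{i+1} = J_i S_{i+1}` (`span_pow_mul_looseTransform`). [folklore] -/
theorem isLooseThreadChain_of_branch {c : ℕ → MarkedNode K} (hc : ∀ i, LooseStep b (c i) (c (i + 1))) :
    IsLooseThreadChain b (fun i => @looseExponent K _ b (c i).1
        (hc i).isIsolatedNode.isSingularNode.1.toIsLocalRing (c i).2)
      (fun i => (c i).1) (fun i => (c i).2) := by
  have hiso : ∀ i, IsIsolatedNode b (c i) := fun i => (hc i).isIsolatedNode
  have hreg : ∀ i, IsRegularLocalRing (c i).1 := fun i => (hiso i).isSingularNode.1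
  have hb : 0 < b := (hiso 0).b_pos
  refine
    { b_pos := hb
      le_exponent := fun i => ?_
      isLocalRingOf := ?_
      isRegularLocalRing := hreg
      ringKrullDim_le := fun i => ?_
      isQuadraticTransform := fun i => (hc i).isQuadraticTransform
      transform := fun i x hx1 hmx => ?_
      ne_bot := fun i => (hiso i).ne_bot
      le_pow := fun i => ?_
      not_le_span_pow := fun i π hπ _ => (hiso i).2.1 π hπ
      finite_integralClosure := fun i P hP => (hiso i).2.2 P hP }
  · -- `b ≤ m_i`
    haveI := hreg i
    have h := hiso i
    exact le_looseExponent hb (IsIsolatedNode.le_exactOrder (S := (c i).1) (J := (c i).2) h)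
  · obtain ⟨⟨_, -, hof, -⟩, -, -⟩ := hiso 0
    exact hof
  · obtain ⟨⟨_, hdim, -, -⟩, -, -⟩ := hiso i
    exact hdim.le
  · -- the product law
    haveI := hreg i
    have he : (c (i + 1)).2 = looseTransform b (c i).1 (c i).2 (c (i + 1)).1 :=
      (hc i).snd_eq (hreg i).toIsLocalRing
    rw [he]
    exact span_pow_mul_looseTransform b (hc i).isQuadraticTransform.dominates.1 ⟨x, hx1⟩ hmx
  · obtain ⟨⟨_, -, -, hle⟩, -, -⟩ := hiso i
    exact hle

/-- **There is no infinite sequence of loose steps** (the loose thread-chain theorem, `not_isLooseThreadChain`).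
[cite: ZariskiSamuel1960, Appendix 5] -/
theorem no_infinite_looseBranch (c : ℕ → MarkedNode K) (hc : ∀ i, LooseStep b (c i) (c (i + 1))) : False :=
  not_isLooseThreadChain b _ _ _ (isLooseThreadChain_of_branch hc)

/-! ## Finiteness of the loose tree and the centre inequality -/

/-- **The loose exit tree above every node is finite.** [cite: ZariskiSamuel1960, Appendix 5] -/
theorem finite_looseExitTree (b : ℕ) (n₀ : MarkedNode K) : (looseExitTree b n₀).Finite :=
  finite_looseExitTree_of_no_infinite_branch n₀ fun c _ hc => no_infinite_looseBranch c hc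

/-- **THE CENTRE INEQUALITY of rung (i-b) (surface germ, local algebra).** At an isolated node `⟨S, J⟩` (`S` a
two-dimensional regular local ring of `K` with Japanese prime quotients, `J ⊆ 𝔪^b`, no prime `q` with `J ⊆ (q^b)`), for
every finite set `F` of distinct two-dimensional first quadratic transforms `S'` of `S`:
`∑_{S' ∈ F} ν̃(S', (J S' : (𝔪 S')^m), b) < ν̃(S, J, b)`, `m = b·⌊ord J/b⌋` — the loose exit count drops when the point is
blown up and the exceptional curve is then blown up as often as forced. [cite: ZariskiSamuel1960, Appendix 5] -/
theorem sum_looseExitCount_lt_of_isIsolatedNode {S : Subring K} [IsRegularLocalRing S] {J : Ideal S}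
    (hS : IsIsolatedNode b (⟨S, J⟩ : MarkedNode K)) (F : Finset (Subring K))
    (hF : ∀ S' ∈ F, IsQuadraticTransform S S' ∧ ringKrullDim S' = 2) :
    ∑ S' ∈ F, looseExitCount b S' (looseTransform b S J S') < looseExitCount b S J :=
  sum_looseExitCount_lt hS (finite_looseExitTree b _) F hF

/-- A positive loose exit count at every singular node. [folklore] -/
theorem one_le_looseExitCount_of_isSingularNode {S : Subring K} {J : Ideal S}
    (h : IsSingularNode b (⟨S, J⟩ : MarkedNode K)) : 1 ≤ looseExitCount b S J :=
  one_le_looseExitCount h (finite_looseExitTree b _)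

end Summit.ResolutionOfSingularities.ResolutionOfSingularities.Theorems.CampaignW46

end
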